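import Summits.Ventures.PercRepro.RankLevelSetPerElemLow
import Summits.Ventures.PercRepro.RankLevelSetAbsorbStarThree

/-! # RankLevelSetPerElemTwo — THE PER-ELEMENT INEQUALITY (★★) AT LEVEL `2` AND THE MONOTONE STEP `j = 2` OF
THE BI-INDEPENDENT PROFILE, FOR EVERY FINITE MATROID; HENCE THE STEP `k = 3` OF (ABS-star) FOR EVERY ELEMENT,
PARALLEL OR NOT (night-1 g35; dossier §47; on `RankLevelSetPerElemLow`)

THEOREM (**`perElemAt_two`**): for every finite matroid on `6 ≤ n` elements and every `y ∈ E`,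
`#{Z ∈ D_2 : y ∉ Z} ≤ #{Q ∈ D_3 : y ∈ Q}`. A loop `y` has no bi-independent set avoiding it; for `y` in a
parallel pair `{y, z}` the inequality is `D_1(N) ≤ D_2(N)` for the minor `N = M ／ {y} ＼ {z}` on `n − 2 ≥ 4`
elements (`RankLevelSetPerElemLow`). For a `y` without a parallel partner the FREE sets `Z` (`y ∉ cl Z`) go to
`insert y Z`, and an ABSORBING `2`-set `Z = {a, b}` (`y ∈ cl Z`, so `{y, a, b}` is a circuit,
`insert_isCircuit_of_absorb_two`) goes to a THROUGH-`y` triple `{y, e, e'}` with `e, e'` outside `Z ∪ {y}`, itself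
bi-independent (**`exists_through_triple`**: `J := E ∖ (Z ∪ {y})` is independent with `#J = n − 3 ≥ 3`; if `J`
has a non-coloop `e` then `E ∖ {e}` is spanning, `E ∖ {e, e'}` has rank `≥ n − 3` for every `e'`, and `y` lies
in the closure of `E ∖ {y, e, e'} ⊇ Z`, which is therefore independent; if every element of `J` is a coloop,
`E ∖ {y} = Z ∪ J` is independent; then `e' ∈ J ∖ {e}` is taken off the line through `y` and `e`
(`exists_off_line`: two such elements would put an independent `3`-set into the rank-`2` flat `cl {y, e}`)).
The map is injective: two absorbing sets with the same image have the same circuit — the fundamental circuit of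
`y` in the independent complement of the image — and a free set never shares its image with an absorbing one (the
complement of a free set is independent through `y`). Summed over `y`: **`mono_step_two`**,
`(n − 2) · D_2 ≤ 3 · D_3` for EVERY finite matroid with `6 ≤ n`.

COROLLARY (**`absorbStar_step_three_all`**): for every finite matroid, every `y ∈ E` and `7 ≤ n`,
`(n − 4) · A^y_3 ≤ 3 · A^y_4` — g34's `absorbStar_step_three` needed `y` in no parallel pair; for a parallel pair
`{y, z}` the step is the monotone step `j = 2` of `M ／ {y} ＼ {z}` (g32's `lowAbsorbCount_succ_of_parallel_left`),
i.e. `mono_step_two` on `n − 2 ≥ 6` elements, or the symmetry `D_2 = D_3` on `5` elements; a loop absorbs nothing.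
Hence **`absorbStar_of_le_three_all`**: (ABS-star) holds at every step `k ≤ 3` of every finite matroid at every
element. Every declaration has a docstring; imports: the cell's own modules and Mathlib only. Axioms: standard. -/

namespace PercRepro

open Set Matroid

variable {α : Type} (M : Matroid α) [M.Finite]

/-! ## Level `2`: the through-`y` triple of an absorbing pair -/

/-- **THE THROUGH-`y` TRIPLE OF AN ABSORBING PAIR**: for `y ∈ E` in no parallel pair, `6 ≤ #E`, and a
bi-independent `2`-set `Z` with `y ∉ Z`, `y ∈ cl Z`, there are `e ≠ e'` outside `Z ∪ {y}` with `{y, e, e'}` and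
`E ∖ {y, e, e'}` both independent. PROOF. `J := E ∖ (Z ∪ {y})` is independent with `#J = #E − 3 ≥ 3`. If `J` has a
non-coloop `e`, then `E ∖ {e}` is spanning, so `E ∖ {e, e'}` has rank `≥ #E − 3` for every `e'`, and `y` lies in
the closure of `E ∖ {y, e, e'} ⊇ Z`, which therefore has rank `≥ #E − 3 = ` its size: independent. If every
element of `J` is a coloop, `E ∖ {y} = Z ∪ J` is independent. Then `e' ∈ J ∖ {e}` is chosen off the line
through `y` and `e` (`exists_off_line`), which makes `{y, e, e'}` independent. -/
lemma exists_through_triple {y : α} (hy : y ∈ M.E) (hnp : ∀ z, z ≠ y → y ∉ M.closure {z})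
    (hn : 6 ≤ M.E.ncard) {Z : Set α} (hZ : Z ∈ biIndep M 2) (hyZ : y ∉ Z) (hycl : y ∈ M.closure Z) :
    ∃ e e', e ∈ M.E \ insert y Z ∧ e' ∈ M.E \ insert y Z ∧ e ≠ e' ∧ M.Indep {y, e, e'} ∧
      M.Indep (M.E \ {y, e, e'}) := by
  obtain ⟨hZE, hZ2, hZi, hcind⟩ := hZ
  have hyZE : insert y Z ⊆ M.E := Set.insert_subset hy hZE
  have hZfin : Z.Finite := M.ground_finite.subset hZE
  have hJsub : M.E \ insert y Z ⊆ M.E \ Z := Set.sdiff_subset_sdiff_right (Set.subset_insert y Z)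
  have hJi : M.Indep (M.E \ insert y Z) := hcind.subset hJsub
  have hJfin : (M.E \ insert y Z).Finite := M.ground_finite.subset Set.sdiff_subset
  have hJcard : (M.E \ insert y Z).ncard = M.E.ncard - 3 := by
    rw [Set.ncard_sdiff hyZE (M.ground_finite.subset hyZE), Set.ncard_insert_of_notMem hyZ hZfin, hZ2]
  -- Step A: an `e ∈ J` such that `E ∖ {y, e, e'}` is independent for every `e' ∈ J ∖ {e}`
  have hA : ∃ e ∈ M.E \ insert y Z, ∀ e' ∈ M.E \ insert y Z, e' ≠ e → M.Indep (M.E \ {y, e, e'}) := by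
    by_cases hcol : ∃ e ∈ M.E \ insert y Z, ¬ M.IsColoop e
    · obtain ⟨e, heJ, hec⟩ := hcol
      refine ⟨e, heJ, fun e' he'J hne => ?_⟩
      have heE : e ∈ M.E := heJ.1
      have he'E : e' ∈ M.E := he'J.1
      have hye : y ≠ e := fun h => heJ.2 (by rw [← h]; exact Set.mem_insert y Z)
      have hye' : y ≠ e' := fun h => he'J.2 (by rw [← h]; exact Set.mem_insert y Z)
      have hspan : M.Spanning (M.E \ {e}) := by
        by_contra h
        exact hec (Matroid.isColoop_iff_sdiff_not_spanning.mpr h)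
      have h1 : M.eRk (M.E \ {e}) = M.eRank := hspan.eRk_eq
      have hins : M.E \ {e} = insert e' (M.E \ {e, e'}) := by
        ext x
        simp only [Set.mem_sdiff, Set.mem_singleton_iff, Set.mem_insert_iff, not_or]
        constructor
        · rintro ⟨hxE, hxe⟩
          by_cases hxe' : x = e'
          · exact Or.inl hxe'
          · exact Or.inr ⟨hxE, hxe, hxe'⟩
        · rintro (rfl | ⟨hxE, hxe, -⟩)
          · exact ⟨he'E, hne⟩
          · exact ⟨hxE, hxe⟩
      have h2 : M.eRk (M.E \ {e}) ≤ M.eRk (M.E \ {e, e'}) + 1 := by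
        rw [hins]
        exact M.eRk_insert_le_add_one e' _
      have h3 : ((M.E.ncard - 2 : ℕ) : ℕ∞) ≤ M.eRank := by
        have := hcind.encard_le_eRank
        rwa [← (M.ground_finite.subset Set.sdiff_subset).cast_ncard_eq,
          Set.ncard_sdiff hZE hZfin, hZ2] at this
      have h4 : ((M.E.ncard - 3 : ℕ) : ℕ∞) ≤ M.eRk (M.E \ {e, e'}) := by
        have h5 : ((M.E.ncard - 3 : ℕ) : ℕ∞) + 1 ≤ M.eRk (M.E \ {e, e'}) + 1 := by
          calc ((M.E.ncard - 3 : ℕ) : ℕ∞) + 1 = ((M.E.ncard - 2 : ℕ) : ℕ∞) := by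
                norm_cast
                omega
            _ ≤ M.eRank := h3
            _ = M.eRk (M.E \ {e}) := h1.symm
            _ ≤ M.eRk (M.E \ {e, e'}) + 1 := h2
        exact (WithTop.add_le_add_iff_right (by decide)).mp h5
      have hZsub : Z ⊆ M.E \ {y, e, e'} := by
        intro x hx
        refine ⟨hZE hx, ?_⟩
        simp only [Set.mem_insert_iff, Set.mem_singleton_iff, not_or]
        refine ⟨fun h => hyZ (h ▸ hx), fun h => heJ.2 (Set.mem_insert_of_mem y (h ▸ hx)),
          fun h => he'J.2 (Set.mem_insert_of_mem y (h ▸ hx))⟩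
      have hycl2 : y ∈ M.closure (M.E \ {y, e, e'}) := M.closure_subset_closure hZsub hycl
      have hsub : M.E \ {e, e'} ⊆ M.closure (M.E \ {y, e, e'}) := by
        intro x hx
        by_cases hxy : x = y
        · rw [hxy]; exact hycl2
        · refine M.subset_closure _ Set.sdiff_subset ⟨hx.1, ?_⟩
          have hx2 : x ≠ e ∧ x ≠ e' := by simpa using hx.2
          simp only [Set.mem_insert_iff, Set.mem_singleton_iff, not_or]
          exact ⟨hxy, hx2⟩
      have h6 : M.eRk (M.E \ {e, e'}) ≤ M.eRk (M.E \ {y, e, e'}) := by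
        calc M.eRk (M.E \ {e, e'}) ≤ M.eRk (M.closure (M.E \ {y, e, e'})) := M.eRk_mono hsub
          _ = M.eRk (M.E \ {y, e, e'}) := M.eRk_closure_eq _
      have hfin3 : (M.E \ {y, e, e'}).Finite := M.ground_finite.subset Set.sdiff_subset
      have hcard3 : (M.E \ {y, e, e'}).ncard = M.E.ncard - 3 := by
        have hsub3 : ({y, e, e'} : Set α) ⊆ M.E := by
          rintro x (rfl | rfl | rfl)
          · exact hy
          · exact heE
          · exact he'E
        have hc3 : ({y, e, e'} : Set α).ncard = 3 := by
          rw [Set.ncard_insert_of_notMem, Set.ncard_insert_of_notMem, Set.ncard_singleton]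
          · simpa using hne.symm
          · simp only [Set.mem_insert_iff, Set.mem_singleton_iff, not_or]
            exact ⟨hye, hye'⟩
        rw [Set.ncard_sdiff hsub3 (M.ground_finite.subset hsub3), hc3]
      rw [Matroid.indep_iff_eRk_eq_encard_of_finite hfin3]
      refine le_antisymm (M.eRk_le_encard _) ?_
      rw [← hfin3.cast_ncard_eq, hcard3]
      exact h4.trans h6
    · simp only [not_exists, not_and, not_not] at hcol
      have hEy : M.Indep (M.E \ {y}) := by
        have hunion : M.E \ {y} = Z ∪ (M.E \ insert y Z) := by
          ext x
          simp only [Set.mem_sdiff, Set.mem_singleton_iff, Set.mem_union, Set.mem_insert_iff, not_or]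
          constructor
          · rintro ⟨hxE, hxy⟩
            by_cases hxZ : x ∈ Z
            · exact Or.inl hxZ
            · exact Or.inr ⟨hxE, hxy, hxZ⟩
          · rintro (hxZ | ⟨hxE, hxy, -⟩)
            · exact ⟨hZE hxZ, fun h => hyZ (h ▸ hxZ)⟩
            · exact ⟨hxE, hxy⟩
        rw [hunion]
        exact (Matroid.union_indep_iff_indep_of_subset_coloops (fun e he => hcol e he)).mpr hZi
      obtain ⟨e, heJ⟩ : (M.E \ insert y Z).Nonempty := by
        rw [← Set.ncard_pos hJfin]
        omega
      refine ⟨e, heJ, fun e' _ _ => hEy.subset ?_⟩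
      intro x hx
      refine ⟨hx.1, fun h => hx.2 ?_⟩
      rw [Set.mem_singleton_iff] at h
      rw [h]
      exact Set.mem_insert y _
  obtain ⟨e, heJ, hAe⟩ := hA
  have hye : e ≠ y := fun h => heJ.2 (by rw [h]; exact Set.mem_insert y Z)
  have hJ2 : 2 ≤ ((M.E \ insert y Z) \ {e}).ncard := by
    rw [Set.ncard_sdiff_singleton_of_mem heJ, hJcard]
    omega
  obtain ⟨e', he'J, hne, hycl'⟩ := exists_off_line M hy (hnp e hye) hJi hJfin heJ hJ2
  refine ⟨e, e', heJ, he'J, hne.symm, ?_, hAe e' he'J hne⟩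
  have hee' : M.Indep ({e, e'} : Set α) := hJi.subset (by
    rintro x (rfl | rfl)
    · exact heJ
    · exact he'J)
  have hy2 : y ∉ ({e, e'} : Set α) := by
    simp only [Set.mem_insert_iff, Set.mem_singleton_iff, not_or]
    exact ⟨hye.symm, fun h => he'J.2 (by rw [← h]; exact Set.mem_insert y Z)⟩
  rw [show ({y, e, e'} : Set α) = insert y {e, e'} from rfl, hee'.insert_indep_iff_of_notMem hy2]
  exact ⟨hy, hycl'⟩

omit [M.Finite] in
/-- For a bi-independent `2`-set `Z` absorbing `y` (`y ∉ Z`, `y ∈ cl Z`) with `y` in no parallel pair,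
`insert y Z` is a circuit (the triangle `{y, a, b}`). -/
lemma insert_isCircuit_of_absorb_two {y : α} (hnp : ∀ z, z ≠ y → y ∉ M.closure {z}) {Z : Set α}
    (hZi : M.Indep Z) (hZ2 : Z.ncard = 2) (hyZ : y ∉ Z) (hycl : y ∈ M.closure Z) :
    M.IsCircuit (insert y Z) := by
  refine hZi.insert_isCircuit_of_forall hyZ hycl ?_
  obtain ⟨a, b, hab, rfl⟩ := Set.ncard_eq_two.mp hZ2
  have hya : a ≠ y := fun h => hyZ (by rw [h]; exact Set.mem_insert y _)
  have hyb : b ≠ y := fun h => hyZ (by rw [h]; exact Set.mem_insert_of_mem _ rfl)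
  intro f hf
  rcases hf with rfl | hf
  · rw [Set.insert_sdiff_of_mem _ (Set.mem_singleton f), Set.sdiff_singleton_eq_self (by simpa using hab)]
    exact hnp b hyb
  · rw [Set.mem_singleton_iff] at hf
    subst hf
    rw [Set.pair_comm, Set.insert_sdiff_of_mem _ (Set.mem_singleton f),
      Set.sdiff_singleton_eq_self (by simpa using hab.symm)]
    exact hnp a hya

/-- **(★★) AT LEVEL `2` FOR EVERY ELEMENT OF EVERY FINITE MATROID WITH `6 ≤ #E`**:
`#{Z ∈ D_2 : y ∉ Z} ≤ #{Q ∈ D_3 : y ∈ Q}`. The free sets (`y ∉ cl Z`) go to `insert y Z`, the absorbing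
sets to a through-`y` triple (`exists_through_triple`); the map is injective. -/
theorem perElemAt_two {y : α} (hy : y ∈ M.E) (hn : 6 ≤ M.E.ncard) :
    {Z ∈ biIndep M 2 | y ∉ Z}.ncard ≤ {Q ∈ biIndep M 3 | y ∈ Q}.ncard := by
  by_cases hl : M.IsLoop y
  · exact perElemAt_of_isLoop M hl 2
  by_cases hp : ∃ z, ParallelPair M y z
  · obtain ⟨z, hz⟩ := hp
    haveI := contract_delete_finite M y z
    rw [avoid_ncard_of_parallel M hz 1, through_ncard_of_parallel M hz 2]
    apply biIndepCount_one_le_two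
    rw [ncard_ground_contract_delete M hz]
    omega
  simp only [not_exists] at hp
  have hnp : ∀ z, z ≠ y → y ∉ M.closure {z} := fun z hz =>
    notMem_closure_singleton_of_no_partner M hy hl hp hz
  -- the choice of an image for every set
  have hex : ∀ Z : Set α, ∃ Q : Set α, Z ∈ biIndep M 2 → y ∉ Z →
      (Q ∈ biIndep M 3 ∧ y ∈ Q) ∧
        ((y ∉ M.closure Z ∧ Q = insert y Z) ∨ (y ∈ M.closure Z ∧ Z ⊆ M.E \ Q)) := by
    intro Z
    by_cases hZ : Z ∈ biIndep M 2 ∧ y ∉ Z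
    · obtain ⟨hZE, hZ2, hZi, hcind⟩ := hZ.1
      have hZfin : Z.Finite := M.ground_finite.subset hZE
      by_cases hycl : y ∈ M.closure Z
      · obtain ⟨e, e', heJ, he'J, hne, hind, hcind'⟩ :=
          exists_through_triple M hy hnp hn hZ.1 hZ.2 hycl
        refine ⟨{y, e, e'}, fun _ _ => ⟨⟨?_, Set.mem_insert y _⟩, Or.inr ⟨hycl, ?_⟩⟩⟩
        · refine ⟨?_, ?_, hind, hcind'⟩
          · rintro x (rfl | rfl | rfl)
            · exact hy
            · exact heJ.1
            · exact he'J.1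
          · have hye : y ≠ e := fun h => heJ.2 (by rw [← h]; exact Set.mem_insert y Z)
            have hye' : y ≠ e' := fun h => he'J.2 (by rw [← h]; exact Set.mem_insert y Z)
            rw [Set.ncard_insert_of_notMem, Set.ncard_insert_of_notMem, Set.ncard_singleton]
            · simpa using hne
            · simp only [Set.mem_insert_iff, Set.mem_singleton_iff, not_or]
              exact ⟨hye, hye'⟩
        · intro x hx
          refine ⟨hZE hx, ?_⟩
          simp only [Set.mem_insert_iff, Set.mem_singleton_iff, not_or]
          exact ⟨fun h => hZ.2 (h ▸ hx), fun h => heJ.2 (Set.mem_insert_of_mem y (h ▸ hx)),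
            fun h => he'J.2 (Set.mem_insert_of_mem y (h ▸ hx))⟩
      · refine ⟨insert y Z, fun _ _ => ⟨⟨⟨Set.insert_subset hy hZE, ?_, ?_, hcind.subset ?_⟩,
          Set.mem_insert y _⟩, Or.inl ⟨hycl, rfl⟩⟩⟩
        · rw [Set.ncard_insert_of_notMem hZ.2 hZfin, hZ2]
        · rw [hZi.insert_indep_iff_of_notMem hZ.2]
          exact ⟨hy, hycl⟩
        · exact Set.sdiff_subset_sdiff_right (Set.subset_insert y _)
    · exact ⟨∅, fun h1 h2 => absurd ⟨h1, h2⟩ hZ⟩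
  choose f hf using hex
  refine Set.ncard_le_ncard_of_injOn f (fun Z hZ => (hf Z hZ.1 hZ.2).1) ?_
    ((biIndep_finite M 3).subset (fun Q hQ => hQ.1))
  rintro Z₁ ⟨hZ₁, hy₁⟩ Z₂ ⟨hZ₂, hy₂⟩ heq
  have hcomp : ∀ {Z : Set α}, Z ∈ biIndep M 2 → y ∉ Z → y ∈ M.closure Z →
      M.IsCircuit (insert y Z) := fun hZ hyZ hycl =>
    insert_isCircuit_of_absorb_two M hnp hZ.2.2.1 hZ.2.1 hyZ hycl
  -- a free set and an absorbing set never share an image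
  have hmixed : ∀ {Z Z' : Set α}, Z ∈ biIndep M 2 → y ∉ Z → y ∉ M.closure Z → Z' ⊆ M.E \ insert y Z →
      y ∈ M.closure Z' → False := by
    intro Z Z' hZ hyZ hycl hZ' hycl'
    have hI : M.Indep (M.E \ Z) := hZ.2.2.2
    have hyI : y ∈ M.E \ Z := ⟨hy, hyZ⟩
    have hsub : Z' ⊆ (M.E \ Z) \ {y} := by
      intro x hx
      have hx' := hZ' hx
      refine ⟨⟨hx'.1, fun h => hx'.2 (Set.mem_insert_of_mem y h)⟩, fun h => hx'.2 ?_⟩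
      rw [Set.mem_singleton_iff] at h
      rw [h]
      exact Set.mem_insert y Z
    exact hI.notMem_closure_sdiff_of_mem hyI (M.closure_subset_closure hsub hycl')
  obtain ⟨-, h₁⟩ := hf Z₁ hZ₁ hy₁
  obtain ⟨-, h₂⟩ := hf Z₂ hZ₂ hy₂
  rcases h₁ with ⟨hc₁, he₁⟩ | ⟨hc₁, hs₁⟩ <;> rcases h₂ with ⟨hc₂, he₂⟩ | ⟨hc₂, hs₂⟩
  · -- both free
    rw [he₁, he₂] at heq
    have : (insert y Z₁) \ {y} = (insert y Z₂) \ {y} := by rw [heq]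
    rwa [Set.insert_sdiff_of_mem _ (Set.mem_singleton y), Set.insert_sdiff_of_mem _ (Set.mem_singleton y),
      Set.sdiff_singleton_eq_self hy₁, Set.sdiff_singleton_eq_self hy₂] at this
  · -- `Z₁` free, `Z₂` absorbing
    exact (hmixed hZ₁ hy₁ hc₁ (by rw [← he₁, heq]; exact hs₂) hc₂).elim
  · -- `Z₁` absorbing, `Z₂` free
    exact (hmixed hZ₂ hy₂ hc₂ (by rw [← he₂, ← heq]; exact hs₁) hc₁).elim
  · -- both absorbing: both triangles are the fundamental circuit of `y` in the complement of the image
    have hQ := (hf Z₁ hZ₁ hy₁).1.1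
    have hI : M.Indep (M.E \ f Z₁) := hQ.2.2.2
    have hC₁ : insert y Z₁ = M.fundCircuit y (M.E \ f Z₁) :=
      (hcomp hZ₁ hy₁ hc₁).eq_fundCircuit_of_subset hI (Set.insert_subset_insert hs₁)
    have hC₂ : insert y Z₂ = M.fundCircuit y (M.E \ f Z₁) :=
      (hcomp hZ₂ hy₂ hc₂).eq_fundCircuit_of_subset hI (Set.insert_subset_insert (by rw [heq]; exact hs₂))
    have heq' : insert y Z₁ = insert y Z₂ := by rw [hC₁, hC₂]
    have : (insert y Z₁) \ {y} = (insert y Z₂) \ {y} := by rw [heq']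
    rwa [Set.insert_sdiff_of_mem _ (Set.mem_singleton y), Set.insert_sdiff_of_mem _ (Set.mem_singleton y),
      Set.sdiff_singleton_eq_self hy₁, Set.sdiff_singleton_eq_self hy₂] at this

/-- **THE MONOTONE STEP `j = 2` OF EVERY FINITE MATROID WITH `6 ≤ #E`**: `(#E − 2) · D_2 ≤ 3 · D_3`. -/
theorem mono_step_two (hn : 6 ≤ M.E.ncard) : (M.E.ncard - 2) * biIndepCount M 2 ≤ 3 * biIndepCount M 3 :=
  mono_step_of_perElemAt M 2 (fun _ hy => perElemAt_two M hy hn)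

/-! ## The step `k = 3` of (ABS-star) at every element -/

omit [M.Finite] in
/-- A loop absorbs nothing: `lowAbsorbAt M y k = ∅`, as the complement of a member would contain the loop. -/
lemma lowAbsorbAt_eq_empty_of_isLoop {y : α} (hl : M.IsLoop y) (k : ℕ) : lowAbsorbAt M y k = ∅ := by
  have hsub : lowAbsorbAt M y k ⊆ {Z ∈ biIndep M k | y ∉ Z} := fun Z hZ => ⟨hZ.1, hZ.2.1⟩
  rw [avoid_eq_empty_of_isLoop M hl k] at hsub
  exact Set.subset_empty_iff.mp hsub

omit [M.Finite] in
/-- `A^y_k = 0` for a loop `y`. -/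
lemma lowAbsorbCount_eq_zero_of_isLoop {y : α} (hl : M.IsLoop y) (k : ℕ) : lowAbsorbCount M y k = 0 := by
  unfold lowAbsorbCount
  rw [lowAbsorbAt_eq_empty_of_isLoop M hl k, Set.ncard_empty]

/-- **THE STEP `k = 3` OF (ABS-star) AT AN ELEMENT OF A PARALLEL PAIR**: for a parallel pair `{y, z}` and
`7 ≤ #E`, `(#E − 4) · A^y_3 ≤ 3 · A^y_4` — by g32's identity `A^y_{j+1}(M) = D_j(N)` for `N = M ／ {y} ＼ {z}`
this is the monotone step `j = 2` of `N` (`mono_step_two` on `#E − 2 ≥ 6` elements), and on `5` elements the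
symmetry `D_2(N) = D_3(N)`. -/
theorem absorbStar_step_three_of_parallel {y z : α} (h : ParallelPair M y z) (hn : 7 ≤ M.E.ncard) :
    (M.E.ncard - 4) * lowAbsorbCount M y 3 ≤ 3 * lowAbsorbCount M y 4 := by
  haveI := contract_delete_finite M y z
  have hcard := ncard_ground_contract_delete M h
  rw [lowAbsorbCount_succ_of_parallel_left M h 2, lowAbsorbCount_succ_of_parallel_left M h 3]
  rcases Nat.lt_or_ge M.E.ncard 8 with h7 | h8
  · have hm : M.E.ncard = 7 := by omega
    have hsym := biIndepCount_compl ((M.contract {y}).delete {z}) 2 (by rw [hcard]; omega)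
    rw [hcard, hm] at hsym
    rw [hm]
    have h3 : (7 - 2 - 2 : ℕ) = 3 := by norm_num
    rw [h3] at hsym
    rw [show (7 - 4 : ℕ) = 3 by norm_num, hsym]
  · have hstep := mono_step_two ((M.contract {y}).delete {z}) (by rw [hcard]; omega)
    rw [hcard] at hstep
    rw [show M.E.ncard - 4 = M.E.ncard - 2 - 2 by omega]
    exact hstep

/-- **THE STEP `k = 3` OF (ABS-star) FOR EVERY FINITE MATROID AND EVERY ELEMENT**: for `y ∈ E` and `7 ≤ #E`,
`(#E − 4) · A^y_3 ≤ 3 · A^y_4` — a loop absorbs nothing, an element of a parallel pair reduces to the monotone step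
of the minor (`absorbStar_step_three_of_parallel`), and an element in no parallel pair is g34's
`absorbStar_step_three`. -/
theorem absorbStar_step_three_all [DecidableEq α] {y : α} (hy : y ∈ M.E) (hn : 7 ≤ M.E.ncard) :
    (M.E.ncard - 4) * lowAbsorbCount M y 3 ≤ 3 * lowAbsorbCount M y 4 := by
  by_cases hl : M.IsLoop y
  · rw [lowAbsorbCount_eq_zero_of_isLoop M hl 3, Nat.mul_zero]
    exact Nat.zero_le _
  by_cases hp : ∃ z, ParallelPair M y z
  · obtain ⟨z, hz⟩ := hp
    exact absorbStar_step_three_of_parallel M hz hn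
  simp only [not_exists] at hp
  exact absorbStar_step_three M hy (fun z hz => notMem_closure_singleton_of_no_partner M hy hl hp hz) hn

/-- **(ABS-star) HOLDS AT EVERY STEP `k ≤ 3` OF EVERY FINITE MATROID AT EVERY ELEMENT**: for `y ∈ E`, `k ≤ 3`
and `2k + 1 ≤ #E`, `(#E − 1 − k) · A^y_k ≤ k · A^y_{k+1}` (g34's `absorbStar_of_le_two` for `k ≤ 2`,
`absorbStar_step_three_all` for `k = 3`) — the shape of `BiIndepAbsorbStar` at the steps `k ≤ 3`, with no
hypothesis on the matroid. -/
theorem absorbStar_of_le_three_all [DecidableEq α] {y : α} (hy : y ∈ M.E) {k : ℕ} (hk3 : k ≤ 3)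
    (hk : 2 * k + 1 ≤ M.E.ncard) :
    (M.E.ncard - 1 - k) * lowAbsorbCount M y k ≤ k * lowAbsorbCount M y (k + 1) := by
  rcases Nat.lt_or_ge k 3 with h2 | h3
  · exact absorbStar_of_le_two M hy (by omega) hk
  · have hk3' : k = 3 := by omega
    subst hk3'
    rw [show M.E.ncard - 1 - 3 = M.E.ncard - 4 by omega]
    exact absorbStar_step_three_all M hy (by omega)


/-! ## Two classes on which (ABS-star) is now a theorem -/

/-- **(ABS-star) holds on every matroid with at most `8` elements**: every step in range has `k ≤ 3`. -/
theorem absorbStar_of_ncard_le_eight [DecidableEq α] (hn : M.E.ncard ≤ 8) : BiIndepAbsorbStar M :=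
  fun y hy k hk => absorbStar_of_le_three_all M hy (by omega) hk

omit [M.Finite] in
/-- A bi-independent `k`-set needs `#E − k ≤ eRank` (its complement is independent): for `2k + 1 ≤ #E` and
`eRank ≤ 4` there is none with `k ≥ 4`. -/
lemma lowAbsorbAt_eq_empty_of_eRank_le_four (hr : M.eRank ≤ 4) {y : α} {k : ℕ} (hk : 2 * k + 1 ≤ M.E.ncard)
    (hk4 : 4 ≤ k) : lowAbsorbAt M y k = ∅ := by
  rw [Set.eq_empty_iff_forall_notMem]
  rintro Z ⟨⟨hZE, hZk, -, hcind⟩, -, -⟩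
  have hfin : M.E.Finite := Set.finite_of_ncard_pos (by omega)
  have h1 := hcind.encard_le_eRank
  rw [← (hfin.subset Set.sdiff_subset).cast_ncard_eq, Set.ncard_sdiff hZE (hfin.subset hZE), hZk] at h1
  have h2 : ((M.E.ncard - k : ℕ) : ℕ∞) ≤ 4 := h1.trans hr
  have h3 : M.E.ncard - k ≤ 4 := by exact_mod_cast h2
  omega

/-- **(ABS-star) holds on every matroid of rank at most `4`**: the steps `k ≤ 3` are theorems, and at `k ≥ 4` no
bi-independent `k`-set exists in the range `2k + 1 ≤ #E`. -/
theorem absorbStar_of_eRank_le_four [DecidableEq α] (hr : M.eRank ≤ 4) : BiIndepAbsorbStar M := by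
  intro y hy k hk
  rcases Nat.lt_or_ge k 4 with h3 | h4
  · exact absorbStar_of_le_three_all M hy (by omega) hk
  · have : lowAbsorbCount M y k = 0 := by
      unfold lowAbsorbCount
      rw [lowAbsorbAt_eq_empty_of_eRank_le_four M hr hk h4, Set.ncard_empty]
    rw [this, Nat.mul_zero]
    exact Nat.zero_le _

end PercRepro
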